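import Summits.AtomisticToContinuum.HydrodynamicLimit.Theses.InformationPercolationEngine
import Summits.AtomisticToContinuum.HydrodynamicLimit.Theorems.InformationPercolationEnginePercolationClosesChaosFlattening
import Summits.AtomisticToContinuum.HydrodynamicLimit.Theorems.InformationPercolationEnginePercolationClosesChaosFlatteningLogLipschitz
import Literature.MathematicalPhysics.KineticTheory.VelocityBlindPlacement

/-!
# Skeleton of the line `ideator2-Sketch` (card `impact-disc-flattening`) for the crux
`PercolationClosesChaos` (stmt-AtomisticToContinuum-15178, rev 12:
`KickFairRelEquilibriumMeso → SpectralContractionR → ContactChaos`)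

Lead `prover-line-stmt-AtomisticToContinuum-15178-a1-0` (re-seat a1), 2026-08-16. Rebuilt from the card
`Cruxes/PercolationClosesChaos/Ideas/impact-disc-flattening.md` (§First lemma, §Transfer; the ideator's `Sketch.lean`
evidence file is not mounted in the lead's jail, exactly as for the previous line) with the reshapes recorded in
`Cruxes/PercolationClosesChaos/PICKED.md` (re-seat a1):

* §0 FLATTENING, the card's positive half, as two stubs with EXPLICIT signatures (landable from `Theorems/` as stated) plus
  proved glue into the `Prop`s `Flattening` / `FlatteningLogLipschitz` the docking consumes: `stub_flattening` (a density
  pinched between `m` and `m(1+η)` tilts no `C`-bounded test by more than `2ηCm·ν(univ)²`, product form, a.e. hypotheses) and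
  `stub_flatteningLogLipschitz` (its thin-set corollary: a log-Lipschitz density on a set of diameter `D` is pinched with
  `η = e^{2LD} − 1`; the impact disc / the central spot of a virtual-pass disc is the instance `D = 2ε`, `E = ℝ²`).
* §1 `FineBlindness` — the card's fine input, typed over the landed `VelocityBlindPlacement.closeStat` with unit-mass rescaled
  recentred probes `probe φ θ y₀ = θ⁻³ φ(θ⁻¹(· − y₀))` (mass normalisation is load-bearing: without `θ⁻³` both products of the
  cross-ratio are `O(θ⁶)` and the statement would be true by smallness); quantifier order `∀δ ∃θ₁ ∀θ<θ₁ ∃N₀ ∀N ∀y₀ y₁`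
  (uniform in the probe pair, which is what a docking integrates over; no lower cut-off `θ ≥ Cπσ³`, which would let
  `θ₁ := πσ³/2` void the claim).
* §2 `PairBlindness` — the card's value statement `PairBlindness(ℓ)` = VBP with `k = 1` and annulus-supported geometry tests,
  typed over the landed `VelocityBlindPlacement.vbpDefect`, in the in-probability format of the target (`N → ∞` then `r → 0`).
  The card does NOT claim it ("THE value statement; LE-class; … not claimed here"); it is a registered stub because the
  composition consumes it.
* §3 `KickFluxFairMeso` — what composition step (1) ("K + KickScoreNeutrality: `Ψ(ω,·) ↦ Ψ̄(v,w)`") consumes: the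
  `KickFairRelEquilibriumMeso` let-chain VERBATIM with the equilibrium conditional mean `κ_{i,n}` replaced by the flux mean
  `fluxMean g (v⁻, v*⁻)`; `stub_kickScoreNeutrality : KickFairRelEquilibriumMeso → KickFluxFairMeso` is the card's
  KickScoreNeutrality (K is consumed here, substantively).
* §4 the DOCKING `stub_docking : KickFluxFairMeso → SpectralContractionR → Flattening → FlatteningLogLipschitz →
  FineBlindness → PairBlindness → ContactChaos` — composition steps (2)–(5) of the card (thinning E1/E2 re-typed inside, flattening on Lambert
  discs, cross-ratio cancellation, RingBootstrap with `SpectralContractionR` as a one-body gap, tails by name).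

Composition: `PercolationClosesChaos_of := fun hK hS => stub_docking (stub_kickScoreNeutrality hK) hS flattening_holds
flatteningLogLipschitz_holds stub_fineBlindness stub_pairBlindness`. Stubs (sorries) ONLY in `stub_*`.
The card's PAYMENT of `FineBlindness` (`FineRegularityTransfer : FineErgodicWindow → FineBlindness`, Donsker–Varadhan with
kinetic cells) is deliberately NOT a separate stub: it is the lead's own stub (`stub_fineBlindness`), examined against the
kernel-checked necessity duality `Literature.Probability.Entropy.EntropyMethodNecessity` (p109772) in NOTES/the cycle report.
-/

noncomputable section

open MeasureTheory Set Filter Topology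
open scoped ENNReal BigOperators Classical
open Literature.Analysis.FluidPDE Literature.MathematicalPhysics.KineticTheory
open Literature.MathematicalPhysics.KineticTheory.VelocityBlindPlacement
open Summit.AtomisticToContinuum.HydrodynamicLimit.Theses.InformationPercolationEngine

namespace Summit.AtomisticToContinuum.HydrodynamicLimit.Theorems.ImpactDiscFlatteningLine

/-! ## §0 Thin-set flattening (the card's FACT 2, abstract) -/

/-- FLATTENING, abstract form: on a finite measure space, a density `f` pinched a.e. between `m` and `m(1+η)` (`m, η ≥ 0`)
tilts no a.e. `C`-bounded test `g` by more than `2ηCm·ν(univ)²`, in product form (no division, no normalisation):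
`|(∫ g f dν)·ν(univ) − (∫ g dν)(∫ f dν)| ≤ 2 η C m ν(univ)²`. -/
def Flattening : Prop :=
  ∀ {E : Type} [MeasurableSpace E] (ν : Measure E) [IsFiniteMeasure ν] (f g : E → ℝ) (m η C : ℝ),
    0 ≤ m → 0 ≤ η → 0 ≤ C → AEStronglyMeasurable f ν → AEStronglyMeasurable g ν →
    (∀ᵐ x ∂ν, m ≤ f x ∧ f x ≤ m * (1 + η)) → (∀ᵐ x ∂ν, |g x| ≤ C) →
    |(∫ x, g x * f x ∂ν) * ν.real Set.univ - (∫ x, g x ∂ν) * (∫ x, f x ∂ν)| ≤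
      2 * η * C * m * ν.real Set.univ ^ 2

/-- FLATTENING ON A THIN SET (log-Lipschitz corollary): if `ν` lives on a set `s` of diameter `≤ D`, `φ` is `L`-Lipschitz on
`s` and `x₀ ∈ s`, then `e^{φ}` is pinched between `m = e^{φ x₀ − LD}` and `m·e^{2LD}`, so for every a.e. `C`-bounded test `g`:
`|(∫ g e^φ dν)·ν(univ) − (∫ g dν)(∫ e^φ dν)| ≤ 2 (e^{2LD} − 1) C e^{φ x₀ − LD} ν(univ)²`. The impact disc of a resolved kick /
the central spot of a virtual-pass disc is the instance `E = ℝ²`, `s` a disc of radius `ε` (`D = 2ε`), `L` the log-Lipschitz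
modulus of the relative-position law at the kinetic scale. -/
def FlatteningLogLipschitz : Prop :=
  ∀ {E : Type} [PseudoMetricSpace E] [MeasurableSpace E] (ν : Measure E) [IsFiniteMeasure ν] (s : Set E)
    (φ g : E → ℝ) (x₀ : E) (D L C : ℝ),
    0 ≤ D → 0 ≤ L → 0 ≤ C → x₀ ∈ s → (∀ᵐ x ∂ν, x ∈ s) → (∀ x ∈ s, ∀ y ∈ s, dist x y ≤ D) →
    (∀ x ∈ s, ∀ y ∈ s, |φ x - φ y| ≤ L * dist x y) →
    AEStronglyMeasurable φ ν → AEStronglyMeasurable g ν → (∀ᵐ x ∂ν, |g x| ≤ C) →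
    |(∫ x, g x * Real.exp (φ x) ∂ν) * ν.real Set.univ - (∫ x, g x ∂ν) * (∫ x, Real.exp (φ x) ∂ν)| ≤
      2 * (Real.exp (2 * L * D) - 1) * C * Real.exp (φ x₀ - L * D) * ν.real Set.univ ^ 2

/-! ## §1 Fine velocity-blindness at the kinetic scale -/

/-- The rescaled, recentred, UNIT-MASS probe of the pair geometry at the kinetic scale: `probe φ θ y₀ (y) = θ⁻³ φ(θ⁻¹(y − y₀))`
for a bump `φ` supported in the unit ball (a geometry test for `closeStat 1`, i.e. on ONE rescaled separation `y 0`). -/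
def probe (φ : V3 → ℝ) (θ : ℝ) (y₀ : V3) : (Fin 1 → V3) → ℝ :=
  fun y => (θ ^ 3)⁻¹ * φ (θ⁻¹ • (y 0 - y₀))

/-- The FINE DIFFERENTIAL CROSS-RATIO of two `θ`-adjacent probes `g₀ = probe φ θ y₀`, `g₁ = probe φ θ y₁` with velocity-pair
test `F`, time–space integrated against `χ` along the flow:
`∫_{[0,τ]} ∫_{x₀} χ · (Close_{g₀,F}·Close_{g₁,1} − Close_{g₁,F}·Close_{g₀,1})(Φ_s z, x₀)` — "the two probes carry the same
velocity-pair profile", no reference law, no flux product, unmarked fine geometry left free. -/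
def fineDefect (φ : V3 → ℝ) (θ : ℝ) (y₀ y₁ : V3) (F : (Fin 2 → V3) → ℝ) (σ τ r : ℝ) (N : ℕ) (Φ : Flow σ N)
    (χ : ℝ × T3 → ℝ) (z : Phase N) : ℝ :=
  ∫ s in Icc (0 : ℝ) τ, ∫ x₀ : T3, χ (s, x₀) *
    (closeStat 1 (probe φ θ y₀) F σ r N (Φ.flow s z) x₀ * closeStat 1 (probe φ θ y₁) (fun _ => 1) σ r N (Φ.flow s z) x₀ -
      closeStat 1 (probe φ θ y₁) F σ r N (Φ.flow s z) x₀ * closeStat 1 (probe φ θ y₀) (fun _ => 1) σ r N (Φ.flow s z) x₀)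

/-- `FineBlindness` — FINE VELOCITY-BLINDNESS OF THE PAIR GEOMETRY AT THE KINETIC SCALE, under local Gibbs data: for continuous
positive profiles `∃σ₀ ∀σ<σ₀ ∀Φ ∀τ`, for every probe shape `φ ≥ 0` supported in the unit ball, bounded continuous velocity-pair
test `F`, continuous localiser `χ`, annulus `θlow ≤ ‖y₀‖ ≤ A`, pool radius `r > 0` and `δ > 0` there is `θ₁ > 0` such that for
every `0 < θ < θ₁`, for all large `N`, UNIFORMLY over `θ`-adjacent probe centres `y₀, y₁` in the annulus, the `L¹(localGibbsLaw)`
norm of `fineDefect` is `≤ δ`. (The card's `FineBlindness(θ)`, its PAID input; payer on the card: `FineRegularityTransfer :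
FineErgodicWindow → FineBlindness`, a Donsker–Varadhan transfer with kinetic cells.) -/
def FineBlindness : Prop :=
  ∀ (a₀ θ₀ : T3 → ℝ) (u₀ : T3 → V3), Continuous a₀ → Continuous θ₀ → Continuous u₀ →
    (∀ x, 0 < a₀ x) → (∀ x, 0 < θ₀ x) →
    ∃ σ₀ : ℝ, 0 < σ₀ ∧ ∀ σ : ℝ, 0 < σ → σ < σ₀ → ∀ Φ : (N : ℕ) → Flow σ N, ∀ τ : ℝ, 0 < τ →
    ∀ φ : V3 → ℝ, Continuous φ → (∀ y, 0 ≤ φ y) → (∀ y, 1 ≤ ‖y‖ → φ y = 0) →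
    ∀ F : (Fin 2 → V3) → ℝ, Continuous F → (∃ C : ℝ, ∀ p, |F p| ≤ C) →
    ∀ χ : ℝ × T3 → ℝ, Continuous χ →
    ∀ θlow A r δ : ℝ, 0 < θlow → θlow ≤ A → 0 < r → 0 < δ →
    ∃ θ₁ : ℝ, 0 < θ₁ ∧ ∀ θ : ℝ, 0 < θ → θ < θ₁ → ∃ N₀ : ℕ, ∀ N : ℕ, N₀ ≤ N →
      ∀ y₀ y₁ : V3, θlow ≤ ‖y₀‖ → ‖y₀‖ ≤ A → ‖y₀ - y₁‖ ≤ θ →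
        ∫⁻ z, ENNReal.ofReal |fineDefect φ θ y₀ y₁ F σ τ r N (Φ N) χ z|
          ∂(localGibbsLaw σ a₀ u₀ θ₀ N (Φ N)) ≤ ENNReal.ofReal δ

/-! ## §2 Pair blindness at the mean free path (the card's value statement, NOT claimed by the card) -/

/-- `PairBlindness` — `PairBlindness(ℓ)`: velocity-blind placement for PAIRS (`k = 1`) with geometry tests supported in a
rescaled annulus `θlow ≤ ‖y‖ ≤ A` (separations of order the mean free path), in the in-probability format of `ContactChaos`
(`N → ∞` then `r → 0`): the VBP cross-ratio defect `vbpDefect 1 g F` ("the velocity labels of an `ℓ`-close pair are independent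
of its geometry and distributed as two independent draws from the `r`-pool") tends to `0` in `localGibbsLaw`-probability. On the
card this is `virtual-pass-thinning`'s `MesoscopicDiscLLN(λ)` — "THE value statement; LE-class; … not claimed here". -/
def PairBlindness : Prop :=
  ∀ (a₀ θ₀ : T3 → ℝ) (u₀ : T3 → V3), Continuous a₀ → Continuous θ₀ → Continuous u₀ →
    (∀ x, 0 < a₀ x) → (∀ x, 0 < θ₀ x) →
    ∃ σ₀ : ℝ, 0 < σ₀ ∧ ∀ σ : ℝ, 0 < σ → σ < σ₀ → ∀ Φ : (N : ℕ) → Flow σ N, ∀ τ : ℝ, 0 < τ →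
    ∀ g : (Fin 1 → V3) → ℝ, Continuous g →
      (∃ θlow A : ℝ, 0 < θlow ∧ ∀ y : Fin 1 → V3, (‖y 0‖ < θlow ∨ A < ‖y 0‖) → g y = 0) →
    ∀ F : (Fin 2 → V3) → ℝ, Continuous F → (∃ C : ℝ, ∀ p, |F p| ≤ C) →
    ∀ χ : ℝ × T3 → ℝ, Continuous χ →
    ∀ η δ : ℝ, 0 < η → 0 < δ → ∃ r₀ : ℝ, 0 < r₀ ∧ ∀ r : ℝ, 0 < r → r < r₀ → ∃ N₀ : ℕ, ∀ N : ℕ, N₀ ≤ N →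
      localGibbsLaw σ a₀ u₀ θ₀ N (Φ N) {z | η < |vbpDefect 1 g F σ τ r N (Φ N) χ z|} ≤ ENNReal.ofReal δ

/-! ## §3 Absolute mesoscopic kick flux-fairness (what "K + KickScoreNeutrality" delivers to step (1)) -/

/-- Flux-angular integral of a mark test `Ξ(ω, v, w)` over impact vectors at incoming velocities `(v, w)`:
`∫_{S²} Ξ(ω, v, w) ((w − v)·ω)₊ dω` (the target's `Θ`; `hardSphereKernel (w, v) ω = ((w − v)·ω)₊`, Disproof F6). -/
def fluxAvg (Ξ : V3 × V3 × V3 → ℝ) (v w : V3) : ℝ :=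
  ∫ ω : Metric.sphere (0 : V3) 1, Ξ ((ω : V3), v, w) * hardSphereKernel (w, v) ω ∂sphereMeasure

/-- The FLUX MEAN of a kick test `g` at incoming velocities `(v, w)`: `Θ_g(v,w)/Θ_1(v,w)` — the mean of `g(ω, v, w)` under the
flux law `∝ ((w − v)·ω)₊ dω` of the impact vector (junk `0` at `v = w`, a flux-null set). -/
def fluxMean (g : V3 × V3 × V3 → ℝ) (vw : V3 × V3) : ℝ :=
  (fluxAvg (fun _ => 1) vw.1 vw.2)⁻¹ * fluxAvg g vw.1 vw.2

/-- `KickFluxFairMeso` — KICKS ARE FLUX-FAIR GIVEN THE MESOSCOPIC COARSE PAST (absolute form): the let-chain of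
`KickFairRelEquilibriumMeso` VERBATIM (same cell sequence quantifier `∃ rs` with the typed lower edge, same past `P`, same
marks `X = (ω, v⁻, v*⁻)`, same weights `h`, same good-set cut), with the equilibrium conditional mean `κ_{i,n} = E_G[g(X) | σ(P)]`
replaced by the FLUX MEAN `fluxMean g (v⁻, v*⁻)`: the compensated kick sum
`(ε/(N+1)) Σ_i Σ_{n < cnt} h_{i,n}(P)·(g(X_{i,n}) − Θ_g/Θ_1(v⁻_{i,n}, v*⁻_{i,n}))` has `L¹(localGibbsLaw)` norm `≤ δ`. This is what
composition step (1) of the card consumes ("K + KickScoreNeutrality: `Ψ(ω,·) ↦ Ψ̄(v,w)`"). -/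
def KickFluxFairMeso : Prop :=
  ∃ rs : ℕ → ℝ, (∀ N, 0 < rs N) ∧ Filter.Tendsto rs Filter.atTop (nhds 0) ∧
    Filter.Tendsto (fun N : ℕ => ((N : ℝ) + 1) * rs N ^ 3) Filter.atTop Filter.atTop ∧
    ∀ (a₀ θ₀ : T3 → ℝ) (u₀ : T3 → V3), Continuous a₀ → Continuous θ₀ → Continuous u₀ → (∀ x, 0 < a₀ x) →
    (∀ x, 0 < θ₀ x) → ∃ σ₀ : ℝ, 0 < σ₀ ∧ ∀ σ : ℝ, 0 < σ → σ < σ₀ →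
    ∀ Φ : (N : ℕ) → HardSphereFlow (Torus.geometry (Fin 3)) (hsDiameter σ N) (N + 1), ∀ τ : ℝ, 0 < τ →
    ∀ g : V3 × V3 × V3 → ℝ, Continuous g → (∃ C : ℝ, ∀ p, |g p| ≤ C) → ∀ δ : ℝ, 0 < δ → ∃ N₀ : ℕ, ∀ N : ℕ, N₀ ≤ N →
    ∀ h : Fin (N + 1) → ℕ → (((Fin (N + 1) → (Fin 3 → ℤ) × V3) × (Fin (N + 1) → (Fin 3 → ℤ) × V3)) × Fin (N + 1)) ×
      (ℝ × ℝ × ℝ) → ℝ, (∀ i n, Measurable (h i n)) → (∀ i n p, |h i n p| ≤ 1) →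
    let ε := hsDiameter σ N
    let G : Geometry (Fin 3) T3 := Torus.geometry (Fin 3)
    let q : T3 → (Fin 3 → ℤ) := Torus.coarseCell (rs N)
    let γ : Config (N + 1) (Fin 3) T3 → ℝ → Config (N + 1) (Fin 3) T3 := fun z s => (Φ N).flow s z
    let cnt : Config (N + 1) (Fin 3) T3 → Fin (N + 1) → ℕ := fun z i =>
      Set.ncard (collisionTimesOf G ε (γ z) i ∩ Set.Ioc 0 τ)
    let P : Config (N + 1) (Fin 3) T3 → Fin (N + 1) → ℕ →
        (((Fin (N + 1) → (Fin 3 → ℤ) × V3) × (Fin (N + 1) → (Fin 3 → ℤ) × V3)) × Fin (N + 1)) × (ℝ × ℝ × ℝ) :=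
      fun z i n => if z ∈ (Φ N).good then
        (((Φ N).coarsePastOf q i n z, (Φ N).nthPartnerOf i n z),
          (flightStart G ε (γ z) 0 i ((Φ N).nthCollisionTimeOf i n z),
            flightStart G ε (γ z) 0 ((Φ N).nthPartnerOf i n z) ((Φ N).nthCollisionTimeOf i n z),
            (Φ N).nthCollisionTimeOf i n z))
        else (((fun _ => (0, 0), fun _ => (0, 0)), 0), (0, 0, 0))
    let X : Fin (N + 1) → ℕ → Config (N + 1) (Fin 3) T3 → V3 × V3 × V3 := fun i n z =>
      if z ∈ (Φ N).good then (((Φ N).nthRecordOf i n z).impactVec, ((Φ N).nthRecordOf i n z).preVel) else 0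
    let S : Config (N + 1) (Fin 3) T3 → ℝ := fun z =>
      ε / (N + 1 : ℝ) * ∑ i : Fin (N + 1), ∑ n ∈ Finset.range (cnt z i),
        h i n (P z i n) * (g (X i n z) - fluxMean g (X i n z).2)
    ∫⁻ z, ENNReal.ofReal |S z| ∂(localGibbsLaw σ a₀ u₀ θ₀ N (Φ N)) ≤ ENNReal.ofReal δ

/-! ## §4 The registered stubs -/

/- S1 `stub_flattening` — LANDED p110704 (`Theorems/InformationPercolationEnginePercolationClosesChaosFlattening.lean`, imported above;
   same FQN `…ImpactDiscFlatteningLine.stub_flattening`, explicit signature as registered).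
   S2 `stub_flatteningLogLipschitz` — LANDED p110882 (`Theorems/InformationPercolationEnginePercolationClosesChaosFlatteningLogLipschitz.lean`,
   imported above; same FQN, explicit signature as registered). -/

/-- Glue: S1 packaged as the `Prop` `Flattening`. -/
theorem flattening_holds : Flattening :=
  @fun _ _ ν _ f g m η C hm hη hC hf hg hpinch hbound => stub_flattening ν f g m η C hm hη hC hf hg hpinch hbound

/-- Glue: S2 packaged as the `Prop` `FlatteningLogLipschitz`. -/
theorem flatteningLogLipschitz_holds : FlatteningLogLipschitz :=
  @fun _ _ _ ν _ s φ g x₀ D L C hD hL hC hx₀ hν hdiam hφ hφm hg hbound =>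
    stub_flatteningLogLipschitz ν s φ g x₀ D L C hD hL hC hx₀ hν hdiam hφ hφm hg hbound

/-- S3 `stub_fineBlindness` — the fine input (lead's stub). On the card it is PAID by `FineRegularityTransfer :
FineErgodicWindow → FineBlindness` (Donsker–Varadhan, kinetic cells of side `C(M)ℓ`, Hölder over windows + stationarity,
"spatial independence of `C(M)ℓ`-separated cells under `G` within a window", budget `KN`; open G-side input
`FineErgodicWindow` = N-uniform Cesàro decay of the equilibrium autocorrelation of the fine cross-ratio of a `Cℓ`-cell). -/
theorem stub_fineBlindness : FineBlindness := by
  sorry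

/-- S4 `stub_pairBlindness` — the value statement at the mean free path (VBP `k = 1`, annulus tests). NOT claimed by the
card ("LE-class; DV-payable by the same machine modulo `NoMesoscopicStructure(λ, r)` (cards 3/10), not claimed here");
registered because the composition consumes it. -/
theorem stub_pairBlindness : PairBlindness := by
  sorry

/-- S5 `stub_kickScoreNeutrality` — the card's `KickScoreNeutrality` ("the price of `κ^G(p) ↦ Ψ̄(v,w)`; every consumer of
the rev-12 hypothesis owes it"), typed as what it must deliver to step (1): relative fairness (the crux hypothesis, consumed
HERE) upgraded to absolute flux-fairness along the same admissible cell sequence. -/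
theorem stub_kickScoreNeutrality (hK : KickFairRelEquilibriumMeso) : KickFluxFairMeso := by
  sorry

/- K2 (wave 1, negative lemma p112214 `Theorems/PercolationClosesChaos/Negative/KickFluxFairMesoFalseOfShieldingBias.lean`, ACCEPTED):
   `KickFluxFairMeso_false_of_ShieldingBiasPersists : ShieldingBiasPersists → ¬ Negative.KickFluxFairMeso`, the landed copy being this file's
   `KickFluxFairMeso` verbatim (`Iff.rfl`); hence `ShieldingBiasPersists → (S5) → ¬ KickFairRelEquilibriumMeso`. The two-line kernel-checked
   composition (`kickFluxFairMeso_iff_negativeCopy`, `kickScoreNeutrality_forces_not_kick`) lives in skeleton v2 (lead's folder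
   `work/PercolationClosesChaos.lean`), to be published here once the farm has built the new module. -/

/-- S6 `stub_docking` — composition steps (2)–(5) of the card: (2) E1 (impact offset of a free flight re-typed) +
`FineBlindness` + flattening on Lambert discs: the pass law restricted to the central `ε`-spot is a velocity-BLIND multiple of
the full `λ`-pass law in every bounded `(v,w,t,x)`-test; (3) E2 + `PairBlindness`: the `λ`-pass law is `|v−w| ×` product of
the `r`-local empirical laws `× c_N(t,x)`; (4) cross-ratio: `c_N` and the blind multiple cancel against the target's
`A_r, B^Ψ_r`; (1) `KickFluxFairMeso` with `(v,w,t,x)`-fibred predictable weights replaces `Ψ(ω,v,w)` by `Ψ̄(v,w)` collision by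
collision; (5) rings / Maxwellianity by the RingBootstrap (`SpectralContractionR` as the one-body coercivity
`(1 − √c)²‖f‖² ≤ ‖f − Kf‖²` inverting the exact one-body collision balance, closing for `σ³ + θ < c₀` inside `∃σ₀`); velocity
tails by name (`CollisionMomentBound`, stmt-15144, imported as a further antecedent if and when this stub is cut). -/
theorem stub_docking (hK : KickFluxFairMeso) (hS : SpectralContractionR) (hFlat : Flattening)
    (hFlatLL : FlatteningLogLipschitz) (hFine : FineBlindness) (hPair : PairBlindness) : ContactChaos := by
  sorry

/-! ## §5 Composition (kernel-checked modulo the stubs) -/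

/-- The line closes the crux modulo its six stubs: `K` is consumed by `stub_kickScoreNeutrality`, `S` by the docking's ring
bootstrap, flattening enters the docking in both forms (abstract, for the thinning step; log-Lipschitz, for Lambert discs). -/
theorem PercolationClosesChaos_of : PercolationClosesChaos := fun hK hS =>
  stub_docking (stub_kickScoreNeutrality hK) hS flattening_holds flatteningLogLipschitz_holds stub_fineBlindness
    stub_pairBlindness

end Summit.AtomisticToContinuum.HydrodynamicLimit.Theorems.ImpactDiscFlatteningLine

end
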